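/-
Copyright (c) 2026 the pub-hodgecm-mathlib formalisation cell (harness21).  Prover seat hodgecm-mathlib-K2E3-p14 (g10) (E3 hand on strike line L1; LEAD F0P6-plan (g15)
BATCH #198 (a) «(F-arch)» follow-on), Track B «K2-LIT» ∕ hLiu418 = `stmt-HodgeConjecture-24832`: U1-glob LEVEL 2-fin, the ARCH-KERNEL branch — (F-tail-arch) FILE 2:
the `htail∞` LETTER of ★ `K2LiuLocalKernelPlacePackageArch` at the record carriers (the arch twin of ★ p863396 `K2LiuLocalKernelTailOfRecord`).  THEOREMS ONLY (no `def` ∕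
`instance` ∕ notation ∕ named-fact hypothesis ∕ `sorry`).
-/
import Summits.HodgeConjecture.HodgeConjecture.Theorems.K2LiuSingularWhittakerArchFactorEuler         -- ★ (F-tail-arch) FILE 1 (this seat): `whittakerDelta_eq_archFactor_mul_of_pureArch`
import Summits.HodgeConjecture.HodgeConjecture.Theorems.K2LiuRankOneSingularEulerContinued            -- ★ (K1a-4) FILE 2 (R90-C14-p02): `tprod_eq_scalarK1_mul_finsetProd_cm`
import Summits.HodgeConjecture.HodgeConjecture.Theorems.K2LiuSiegelEisensteinKindWGlobalIntegrable    -- ★ (x-c): `integrable_conj_unipDeltaChar_mul`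
import HarnessLib

/-!
# Crux `HLiu418`, U1-glob LEVEL 2-fin, arch-kernel branch — (F-tail-arch) FILE 2 `K2LiuLocalKernelArchTailOfRecord`: THE `htail∞` LETTER AT THE RECORD CARRIERS
# `c • W_S(f_s)(h) = Fn(s) · (c · HEAD^{fin}_T(s,h) · [ζ^T_{L⁺}(2s) ∕ (ζ^T_{L⁺}(2s+1)·L^T(2s+2, ε))] · ∏_{v∈D} P_v(s))` on `{n∕2 < re s}`, `Fn` = THE ARCH BLOCK   [KudlaRallis1994 §2; Tan1999 §3–§4]

Cell `hodgecm-mathlib`, crux item hLiu418 = `stmt-HodgeConjecture-24832`; squad K2, strike line L1, LEAD F0P6-plan (g15); U1 desk K2E3-p28 (g3); END pen K2E3-p32 (g3);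
prover K2E3-p14 (g10).  Lane `--supports stmt-HodgeConjecture-24832 --as helper` (count-neutral).  THEOREMS ONLY.  General frame `e : Fin N × Fin M ≃ Fin n` and index `S`.

THE POINT ((F-arch) ★ p863937 `archCornerPackage_cm`'s by-value letter `htail∞`).  At an archimedean kernel place U1-glob LEVEL 2's corner package reads
`c • W_{S♭}(f_s)(h′) = A∞ s · (c′ · HT_f s · sc¹^{↑T}(s) · ∏_{v∈D} P v s)` with `A∞` the ARCH BLOCK and `HT_f` the FINITE head over `⨂_{v∈T} ν_v`.  THIS FILE produces exactly that
identity from letters — the arch twin of ★ `K2LiuLocalKernelTailOfRecord.smul_whittakerDelta_eq_loc_mul_rest_of_letters`, composing three ★ bricks: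
(1) ★ (F-tail-arch) FILE 1 `whittakerDelta_eq_archFactor_mul_of_pureArch` — `W_S(f_s)(h) = ARCH(s) · (HEAD^{fin}_T(s,h) · ∏'_{v∉T} I_v(s))` for a head family pure in the arch slot
(letters `νN νv hνK νinf hmap hχ hfac bA rT hpure hh hw hS` BY VALUE; `hG` DISCHARGED here by ★ (x-c) `integrable_conj_unipDeltaChar_mul` from `χ` unitary + Siegel sections + continuity);
(2) the ARCH READING as ONE by-value letter with an ABSTRACT value `Fn` — `hloc : ARCH(s) = Fn s` on `{n∕2 < re}` (payer: the (K1a-3-arch) continuation lineage ★ p863260 ∕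
★ `K2LiuArchTwistedKTypeBlockContinuation`; U1-glob(σ) then kills `Fn ½` through ★ p863937 §2);
(3) the TAIL COLLAPSE ★ (K1a-4) `tprod_eq_scalarK1_mul_finsetProd_cm` — `∏'_{v∉T} I_v(s) = sc¹^{↑T}(s) · ∏_{v∈D} P_v(s)` from the per-good-place VALUE letter `hI`.
* §1 **`smul_whittakerDelta_eq_arch_mul_rest_of_letters`** — ⊢ `∀ s, n∕2 < re s → c • W_S(f_s)(h) = Fn s · ((c : ℂ) · HT_f s h · sc¹^{↑T}(s) · ∏_{v∈D} P v s)` with `HT_f :=` ★ FILE 1's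
  FINITE head VERBATIM — (F-arch)'s `htail∞` at `s₁ := n∕2` (`= 1` at `n = 2`), `Rst` EXPLICIT in ★ (F-rest)'s input association.
References: [KudlaRallis1994] §2 (2.10)–(2.12); [Tan1999] §3, §4 Prop. 4.8; [MoeglinWaldspurger1995] II.1.7; [CasselsFrohlichANT1967] Ch. XV (Tate) Thm. 3.3.1.
HONEST LABEL.  Count-neutral helper: `HC_CM` is proved only modulo the 7 printed citations (2 remaining named inputs: hLiu418 = `stmt-HodgeConjecture-24832`,
h413 = `stmt-HodgeConjecture-24833`) until rung 0 closes; U1-glob LEVEL 2 stays OPEN (FILE B; arch purity of `stdExtension`; `hdead∞`).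
-/

set_option autoImplicit false
set_option linter.dupNamespace false -- the mandated namespace repeats `HodgeConjecture.HodgeConjecture`

noncomputable section

open scoped Matrix RestrictedProduct ENNReal NNReal Topology ComplexConjugate
open NumberField IsDedekindDomain MeasureTheory Measure Filter Set

namespace Summit.HodgeConjecture.HodgeConjecture.Cruxes.HLiu418.K2LiuLocalKernelArchTailOfRecord

open Literature.NumberTheory.Automorphic Literature.NumberTheory.LFunctions Literature.NumberTheory.GaloisRepresentations
open Literature.NumberTheory.GelbartRogawski1991 Literature.NumberTheory.GelbartRogawski1991.GRConstruction
open Literature.NumberTheory.K2Lit.SiegelDoubled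
open Literature.NumberTheory.K2Lit.PlaceSplitting
open Literature.MeasureTheory.RestrictedProduct
open Literature.Topology.Algebra.RestrictedProduct (inH)
open Summit.HodgeConjecture.HodgeConjecture.Cruxes.HLiu418.K2LiuSiegelUnipotentLocalDefs
open Summit.HodgeConjecture.HodgeConjecture.Cruxes.HLiu418.K2LiuSiegelUnipotentSplitDefs
open Summit.HodgeConjecture.HodgeConjecture.Cruxes.HLiu418.K2LiuSiegelUnipotentSplitAtDefs
open Summit.HodgeConjecture.HodgeConjecture.Cruxes.HLiu418.K2LiuSiegelUnipotentFourierDefs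
open Summit.HodgeConjecture.HodgeConjecture.Cruxes.HLiu418.K2LiuSingularWhittakerArchFactorEuler (whittakerDelta_eq_archFactor_mul_of_pureArch)
open Summit.HodgeConjecture.HodgeConjecture.Cruxes.HLiu418.K2LiuRankOneSingularEulerContinued (tprod_eq_scalarK1_mul_finsetProd_cm)
open Summit.HodgeConjecture.HodgeConjecture.Cruxes.HLiu418.K2LiuSiegelEisensteinKindWGlobalIntegrable (integrable_conj_unipDeltaChar_mul)

variable (L : Type) [Field L] [NumberField L] [IsCMField L]
variable {N M n : ℕ} (e : Fin N × Fin M ≃ Fin n)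
  (dV : Fin N → L) (hdV : ∀ i, IsCMField.complexConj L (dV i) = dV i)
  (dW : Fin M → L) (hdW : ∀ i, IsCMField.complexConj L (dW i) = dW i)
  (T : Finset (HeightOneSpectrum (𝓞 (Fp L)))) [DecidableEq (HeightOneSpectrum (𝓞 (Fp L)))]
  [MeasurableSpace ↥(unipDelta L e dV hdV dW hdW)] [BorelSpace ↥(unipDelta L e dV hdV dW hdW)]
  [MeasurableSpace ↥(unipDeltaArch L e dV hdV dW hdW)] [BorelSpace ↥(unipDeltaArch L e dV hdV dW hdW)]
  [∀ v : HeightOneSpectrum (𝓞 (Fp L)), MeasurableSpace ↥(unipDeltaLoc L e dV hdV dW hdW v)] [∀ v : HeightOneSpectrum (𝓞 (Fp L)), BorelSpace ↥(unipDeltaLoc L e dV hdV dW hdW v)]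

/-! ## §1 The `htail∞` letter at the record carriers -/

set_option maxHeartbeats 1200000 in -- MEASURED class of ★ p863396 TailOfRecord's statement (800 000 ✗ `whnf`, 1 200 000 ✓): ★ G1's telescope + the `hloc`∕`hI` letters + the collapsed tail; proof is `have`∕`rw`∕`ring` only
/-- **THE `htail∞` LETTER AT THE RECORD CARRIERS.**  ★ (F-tail-arch) FILE 1's letters verbatim (`hG` discharged from `χ` unitary, Siegel sections, continuity), a scalar `c : ℝ`, the ARCH
reading as a letter `hloc : ARCH(s) = Fn s` (abstract `Fn`), and the per-good-place tail value letter `hI : I_v(s) = c^{K1}_v(s) · P_v(s)` off `T` with `P_v = 1` off a finite `D`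
disjoint from `T`.  THEN for `n∕2 < re s`:
`c • W_S(f_s)(h) = Fn s · ((c : ℂ) · HT_f s h · [ζ^{T}(2s) ∕ (ζ^{T}(2s+1)·L^{T}(2s+2, ε_{L∕L⁺}))] · ∏_{v∈D} P_v(s))`, `HT_f` = ★ FILE 1's FINITE head over `⨂_{v∈T} ν_v` — (F-arch)'s `htail∞`
with `Rst` EXPLICIT in ★ (F-rest)'s input association. [cite: KudlaRallis1994, §2] [cite: Tan1999, §3; §4 Prop. 4.8] [cite: MoeglinWaldspurger1995, II.1.7]
[cite: CasselsFrohlichANT1967, Ch. XV (Tate) Thm. 3.3.1] -/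
theorem smul_whittakerDelta_eq_arch_mul_rest_of_letters (hdV0 : ∀ i, dV i ≠ 0) (hdW0 : ∀ i, dW i ≠ 0) (hn : 1 ≤ n)
    (νN : Measure ↥(unipDelta L e dV hdV dW hdW)) [νN.IsHaarMeasure]
    (νv : ∀ v : HeightOneSpectrum (𝓞 (Fp L)), Measure ↥(unipDeltaLoc L e dV hdV dW hdW v)) [∀ v, (νv v).IsHaarMeasure] [∀ v, SigmaFinite (νv v)]
    (hνK : ∀ v, v ∉ T → νv v (((inH (fun v => UnitaryGroup.localInt L (IsCMField.complexConj L) (n + n) (hermD L e dV hdV dW hdW) v) (fun v => unipDeltaLoc L e dV hdV dW hdW v) v) : Subgroup ↥(unipDeltaLoc L e dV hdV dW hdW v)) : Set ↥(unipDeltaLoc L e dV hdV dW hdW v)) = 1)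
    (νinf : Measure ↥(unipDeltaArch L e dV hdV dW hdW)) [SigmaFinite νinf]
    (hmap : Measure.map (unipDeltaSplitAt L e dV hdV dW hdW T) νN =
      νinf.prod ((Measure.pi fun v : T => νv v.1).prod
        (rpMeasure (fun v : {v : HeightOneSpectrum (𝓞 (Fp L)) // v ∉ T} => ((inH (fun v => UnitaryGroup.localInt L (IsCMField.complexConj L) (n + n) (hermD L e dV hdV dW hdW) v) (fun v => unipDeltaLoc L e dV hdV dW hdW v) v.1 : Subgroup ↥(unipDeltaLoc L e dV hdV dW hdW v.1)) : Set ↥(unipDeltaLoc L e dV hdV dW hdW v.1))) (fun v => νv v.1) ∅)))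
    {χ : HeckeCharacter L} (hχu : χ.IsUnitary) (hχ : ∀ v, v ∉ T → ∀ w' : UnitaryGroup.PlacesOver L v, χ.IsUnramifiedAt w'.1)
    {f : ℂ → HA L e dV hdV dW hdW → ℂ} (hsec : ∀ s, IsSiegelDeltaSection L e dV hdV dW hdW χ s (f s)) (hfc : ∀ s, Continuous (f s))
    {fT : ℂ → UnitaryGroup.arch (Fp L) L (IsCMField.complexConj L) (n + n) (hermD L e dV hdV dW hdW) ×
      (Π v : T, UnitaryGroup.localPi L (IsCMField.complexConj L) (n + n) (hermD L e dV hdV dW hdW) v.1) → ℂ}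
    (hfac : IsFactorizableOff L e dV hdV dW hdW T χ f fT)
    -- purity of the head family IN THE ARCH SLOT
    (bA : ℂ → UnitaryGroup.arch (Fp L) L (IsCMField.complexConj L) (n + n) (hermD L e dV hdV dW hdW) → ℂ)
    (rT : ℂ → (Π v : T, UnitaryGroup.localPi L (IsCMField.complexConj L) (n + n) (hermD L e dV hdV dW hdW) v.1) → ℂ)
    (hpure : ∀ (s : ℂ) (a : UnitaryGroup.arch (Fp L) L (IsCMField.complexConj L) (n + n) (hermD L e dV hdV dW hdW))
      (q : Π v : T, UnitaryGroup.localPi L (IsCMField.complexConj L) (n + n) (hermD L e dV hdV dW hdW) v.1),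
      fT s (a, q) = bA s a * rT s q)
    (S : Matrix (Fin n) (Fin n) L) {h : HA L e dV hdV dW hdW}
    (hh : ∀ v, v ∉ T → UnitaryGroup.evalPlace (Fp L) L (IsCMField.complexConj L) (n + n) (hermD L e dV hdV dW hdW) v
      (UnitaryGroup.finPart (Fp L) L (IsCMField.complexConj L) (n + n) (hermD L e dV hdV dW hdW) h) ∈
        UnitaryGroup.localInt L (IsCMField.complexConj L) (n + n) (hermD L e dV hdV dW hdW) v)
    (hw : ∀ v, v ∉ T → UnitaryGroup.evalPlace (Fp L) L (IsCMField.complexConj L) (n + n) (hermD L e dV hdV dW hdW) v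
      (UnitaryGroup.finPart (Fp L) L (IsCMField.complexConj L) (n + n) (hermD L e dV hdV dW hdW) (weylDelta L e dV hdV dW hdW)) ∈
        UnitaryGroup.localInt L (IsCMField.complexConj L) (n + n) (hermD L e dV hdV dW hdW) v)
    (hS : ∀ v, v ∉ T → ∀ (w : UnitaryGroup.PlacesOver L v) (i j : Fin n), ((S i j : L) : w.1.adicCompletion L) ∈ w.1.adicCompletionIntegers L)
    -- the normalising scalar, the ARCH reading (abstract value), the per-good-place tail values
    (c : ℝ) (Fn : ℂ → ℂ)
    (hloc : ∀ s : ℂ, (n : ℝ) / 2 < s.re →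
      ∫ a, conj (unipDeltaChar L e dV hdV dW hdW S
            (UnitaryGroup.archToAdelic (Fp L) L (IsCMField.complexConj L) (n + n) (hermD L e dV hdV dW hdW)
              (a : UnitaryGroup.arch (Fp L) L (IsCMField.complexConj L) (n + n) (hermD L e dV hdV dW hdW))) : ℂ) *
          bA s (UnitaryGroup.archPart (Fp L) L (IsCMField.complexConj L) (n + n) (hermD L e dV hdV dW hdW) (weylDelta L e dV hdV dW hdW) *
                (a : UnitaryGroup.arch (Fp L) L (IsCMField.complexConj L) (n + n) (hermD L e dV hdV dW hdW)) *
                UnitaryGroup.archPart (Fp L) L (IsCMField.complexConj L) (n + n) (hermD L e dV hdV dW hdW) h) ∂νinf = Fn s)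
    (D : Finset (HeightOneSpectrum (𝓞 (Fp L)))) (hDT : ∀ v ∈ D, v ∉ T) (P : HeightOneSpectrum (𝓞 (Fp L)) → ℂ → ℂ)
    (hP1 : ∀ v, v ∉ T → v ∉ D → ∀ s : ℂ, P v s = 1)
    (hI : ∀ s : ℂ, (n : ℝ) / 2 < s.re → ∀ v : {v : HeightOneSpectrum (𝓞 (Fp L)) // v ∉ T},
      ∫ y, conj (unipDeltaChar L e dV hdV dW hdW S
            (locToAdelic L e dV hdV dW hdW v.1 (y : UnitaryGroup.localPi L (IsCMField.complexConj L) (n + n) (hermD L e dV hdV dW hdW) v.1)) : ℂ) *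
          LambdaLoc L e dV hdV dW hdW v.1 χ s
            (UnitaryGroup.evalPlace (Fp L) L (IsCMField.complexConj L) (n + n) (hermD L e dV hdV dW hdW) v.1
                (UnitaryGroup.finPart (Fp L) L (IsCMField.complexConj L) (n + n) (hermD L e dV hdV dW hdW) (weylDelta L e dV hdV dW hdW)) *
              (y : UnitaryGroup.localPi L (IsCMField.complexConj L) (n + n) (hermD L e dV hdV dW hdW) v.1)) ∂(νv v.1) =
        ((1 - (v.1.residueCard : ℂ) ^ (-(2 * s + 1))) *
            (1 - (quadraticHeckeCharCM L).valueAtUniformizer v.1 * (v.1.residueCard : ℂ) ^ (-(2 * s + 2)))) /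
          (1 - (v.1.residueCard : ℂ) ^ (-(2 * s))) * P v.1 s) :
    ∀ s : ℂ, (n : ℝ) / 2 < s.re →
      c • whittakerDelta L e dV hdV dW hdW νN S (f s) h =
        Fn s *
          ((c : ℂ) *
            (∫ q, (∏ v : T, conj (unipDeltaChar L e dV hdV dW hdW S
                    (locToAdelic L e dV hdV dW hdW v.1
                      ((q v : ↥(unipDeltaLoc L e dV hdV dW hdW v.1)) : UnitaryGroup.localPi L (IsCMField.complexConj L) (n + n) (hermD L e dV hdV dW hdW) v.1)) : ℂ)) *
                rT s (fun v : T => UnitaryGroup.evalPlace (Fp L) L (IsCMField.complexConj L) (n + n) (hermD L e dV hdV dW hdW) v.1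
                        (UnitaryGroup.finPart (Fp L) L (IsCMField.complexConj L) (n + n) (hermD L e dV hdV dW hdW) (weylDelta L e dV hdV dW hdW)) *
                      ((q v : ↥(unipDeltaLoc L e dV hdV dW hdW v.1)) : UnitaryGroup.localPi L (IsCMField.complexConj L) (n + n) (hermD L e dV hdV dW hdW) v.1) *
                      UnitaryGroup.evalPlace (Fp L) L (IsCMField.complexConj L) (n + n) (hermD L e dV hdV dW hdW) v.1
                        (UnitaryGroup.finPart (Fp L) L (IsCMField.complexConj L) (n + n) (hermD L e dV hdV dW hdW) h))
                ∂(Measure.pi fun v : T => νv v.1)) *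
            (partialStandardL (↑T : Set (HeightOneSpectrum (𝓞 (Fp L)))) (fun _ => {1}) (2 * s) /
              (partialStandardL (↑T : Set (HeightOneSpectrum (𝓞 (Fp L)))) (fun _ => {1}) (2 * s + 1) *
                partialStandardL (↑T : Set (HeightOneSpectrum (𝓞 (Fp L)))) (fun v => {(quadraticHeckeCharCM L).valueAtUniformizer v}) (2 * s + 2))) *
            ∏ v ∈ D, P v s) := by
  intro s hs
  have hn' : (1 : ℝ) ≤ (n : ℝ) := by exact_mod_cast hn
  have hs' : 1 / 2 < s.re := by linarith
  -- ★ (x-c): the twisted integrand is `L¹(νN)`; ★ (F-tail-arch) FILE 1: isolate the arch slot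
  have hG := integrable_conj_unipDeltaChar_mul L e dV hdV dW hdW hdV0 hdW0 hχu hs (hsec s) (hfc s) νN S h
  have hF2 := whittakerDelta_eq_archFactor_mul_of_pureArch L e dV hdV dW hdW T νN νv hνK νinf hmap hχ hfac bA rT hpure s S hh hw hS hG
  -- ★ (K1a-4): collapse the restricted-product tail to the partial `ζ`∕`L` quotient times the finite product over `D`
  have hDT' : ∀ v ∈ D, v ∉ (↑T : Set (HeightOneSpectrum (𝓞 (Fp L)))) := fun v hv hvT => hDT v hv (Finset.mem_coe.1 hvT)
  have hP1' : ∀ v, v ∉ (↑T : Set (HeightOneSpectrum (𝓞 (Fp L)))) → v ∉ D → P v s = 1 :=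
    fun v hvT hvD => hP1 v (fun h' => hvT (Finset.mem_coe.2 h')) hvD s
  have hcol : (∏' v : {v : HeightOneSpectrum (𝓞 (Fp L)) // v ∉ T},
      ∫ y, conj (unipDeltaChar L e dV hdV dW hdW S
            (locToAdelic L e dV hdV dW hdW v.1 (y : UnitaryGroup.localPi L (IsCMField.complexConj L) (n + n) (hermD L e dV hdV dW hdW) v.1)) : ℂ) *
          LambdaLoc L e dV hdV dW hdW v.1 χ s
            (UnitaryGroup.evalPlace (Fp L) L (IsCMField.complexConj L) (n + n) (hermD L e dV hdV dW hdW) v.1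
                (UnitaryGroup.finPart (Fp L) L (IsCMField.complexConj L) (n + n) (hermD L e dV hdV dW hdW) (weylDelta L e dV hdV dW hdW)) *
              (y : UnitaryGroup.localPi L (IsCMField.complexConj L) (n + n) (hermD L e dV hdV dW hdW) v.1)) ∂(νv v.1)) =
      partialStandardL (↑T : Set (HeightOneSpectrum (𝓞 (Fp L)))) (fun _ => {1}) (2 * s) /
          (partialStandardL (↑T : Set (HeightOneSpectrum (𝓞 (Fp L)))) (fun _ => {1}) (2 * s + 1) *
            partialStandardL (↑T : Set (HeightOneSpectrum (𝓞 (Fp L)))) (fun v => {(quadraticHeckeCharCM L).valueAtUniformizer v}) (2 * s + 2)) *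
        ∏ v ∈ D, P v s := by
    exact tprod_eq_scalarK1_mul_finsetProd_cm L (↑T : Set (HeightOneSpectrum (𝓞 (Fp L)))) hs' D hDT' (fun v => P v s) hP1' _
      (fun v => hI s hs ⟨v.1, fun h' => v.2 (Finset.mem_coe.2 h')⟩)
  rw [Complex.real_smul, hF2, hloc s hs, hcol]
  ring

end Summit.HodgeConjecture.HodgeConjecture.Cruxes.HLiu418.K2LiuLocalKernelArchTailOfRecord

end
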